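import Summits.HubbardSuperconductivity.HubbardSuperconductivity.Theorems.SoloBlindCrutchAxis
import Literature.MathematicalPhysics.QuantumLattice.HubbardGroundStateKineticExcess
import Literature.MathematicalPhysics.QuantumLattice.FreeFermiGasPairingCostLog
import HarnessLib

/-!
# A correlation-energy budget transfers to every ground state of the crutch plane

Solo-blind lineage, Theorem 37 (generation 34). Setting: the BCS-crutch family
`K_{U,g} = hubbardTorus 2 L 1 U - (g/L²) Δ_dᴴΔ_d` of Theorems 23–36 (`U, g ≥ 0`, sector `(2n, S^z = 0)`,
`L ≥ 3`), a normalised sector ground state `φ` of `K_{U,g}`, and the numbers `T = re⟨φ, H₀ φ⟩` (free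
kinetic energy), `E₀ = minEnergyOn H₀ (szSector (2n) 0)`, `D = re⟨φ, Σ_x n_{x↑}n_{x↓} φ⟩` (doublons),
`Y = re⟨φ, Δ_dᴴΔ_d φ⟩` (pair order; `y = Y/L⁴`), `w = (g/L²)·Y` (crutch energy).

* `crutch_groundState_hartree_balance` — testing `K_{U,g}` on the paramagnetic PAIRED Fermi sea `Φ_F`
  (`re_expect_hubbardTorus_pairedFermiSea`, Literature: energy `E₀ + U n²/L²`; its crutch term is `≤ 0`):
  **`T + U·D ≤ E₀ + U·n²/L² + w`** (for `U ≥ 0`, dropping `U·D ≥ 0`, this sharpens the `U·L²` of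
  Theorem 36(i) to `U·n²/L² = U ν² L²`).
* `crutch_groundState_supergradient` / `crutch_groundState_budget` — the TRANSFER: if at a LARGER
  coupling `U + V` (`V ≥ 0`; `V = U` is the doubling form) the PARAMAGNETIC Hartree–Fock energy is
  accurate from below up to a budget `Γ`, `E₀ + (U+V)·n²/L² - Γ ≤ minEnergyOn H_{U+V} (szSector (2n) 0)`,
  then, with `φ` itself as the trial state at `U + V` (`E_{U+V} ≤ T + (U+V)·D`: the supergradient
  inequality of the concave function `U ↦ E(U)`), **`V·(n²/L² - D) ≤ Γ + w`** and
  **`V·(T - E₀) ≤ U·Γ + (U+V)·w`**; doubling form **`U·(n²/L² - D) ≤ Γ + w`, `T - E₀ ≤ Γ + 2w`** (no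
  sign conditions). Every ground state of `K_{U,g}` is within `O(Γ + w)` of the Fermi sea in kinetic
  energy AND in doublon density: the first-order `U n²/L²` of the balance is replaced by the budget `Γ`.
* `crutch_groundState_pairDensity_budget` / `…_log_budget` — with the kinetic pairing costs of the free
  gas (`freeDWavePairing_costs_energy_opt_explicit`, all fillings; `…_log_explicit`, summit fillings):
  **`a√a/32768 ≤ Γ/L² + 2g·y`**, resp. **`√d₀·a/(4096·log(4 + 32/√a)) ≤ Γ/L² + 2g·y`**, if `y ≥ a`
  (`a L² ≥ 4608`, resp. `12800`).
* `hubbard_groundState_budget` / `hubbard_groundState_pairDensity_budget` / `…_log_budget` — `g = 0`: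
  for EVERY normalised sector ground state of the plain Hubbard torus, `T - E₀ ≤ Γ`,
  `U·(n²/L² - D) ≤ Γ`, `a√a/32768 ≤ Γ/L²`, `√d₀·a/(4096·log(4 + 32/√a)) ≤ Γ/L²`.

The budget in print (cited, NOT formalised): V. Bach, J. Poelchau, *Accuracy of the Hartree–Fock
approximation for the Hubbard model*, J. Math. Phys. 38 (1997) 2072–2083, via the Graf–Solovej
correlation estimate; restated as the Theorem of §2 in J. Wojtkiewicz, P. H. Chankowski, Rep. Math.
Phys. 92 (2023) 227–241, arXiv:2209.02361 (we quote the restatement). For a Morse dispersion (the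
square-lattice band `-2(cos k₁ + cos k₂)` is Morse) on a large enough `d = 2` torus, density `ρ = 2n/L²`:
`E_gs - E_hf ≥ -C·(ρ^{2/3} U'^{4/3}(1 + |ln U'|) + ρ^{1/2} U' |Λ|^{-1/4}(1 + |ln |Λ|^{-1/2}|))·|Λ|`, and the
proof (Lemma 1 there compares with the FREE one-particle density matrix `γ₀`, and `tr(t γ_gs) ≥ tr(t γ₀)`)
bounds `E_gs` from below by the PARAMAGNETIC value `E₀ + U' n²/L²` minus the same error; the sector minimum
over `szSector (2n) 0` is the `2n`-particle ground-state energy by `SU(2)` symmetry. So `Γ = Γ_BP(2U, L)`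
is admissible in the doubling form, `Γ_BP/L² → C' ρ^{2/3} U^{4/3}(1 + |ln U|)`; consequently EVERY
ground-state family of the repulsive Hubbard torus at the summit's fillings has `d`-wave pair density `y`
with `√d₀·y/log(4 + 32/√y) ≤ C'' U^{4/3}(1 + |ln U|)` eventually (optimal-cost form
`y ≤ C U^{8/9}(1 + |ln U|)^{2/3}`): the every-ground-state ceiling of Theorems 35′/36 improves from order
`U` to order `U^{4/3}|ln U|`, while the crutch thresholds of Theorems 29–30/36 move only inside the
constant of `e^{-Θ(1/g)}`.

Inputs (kernel, Literature): `re_expect_hubbardTorus_pairedFermiSea`, `exists_fermiSet`,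
`pairedState_mem_szSector`, `star_pairedState_dotProduct_self`, `minEnergyOn_le_rayleigh_of_mem`,
`freeDWavePairing_costs_energy_{opt,log}_explicit`. Own content: the transfer and the algebra. No claim
toward the summit: `Γ_BP` is polynomial in `U` while the conjectured order is `e^{-c/U²}` (R2 of the
lineage's obstruction atlas); the theorem records how far rigorous correlation-energy control of the 2D
Hubbard ground state constrains `d`-wave order in EVERY ground state, crutch or not.
-/

namespace Summit.HubbardSuperconductivity.HubbardSuperconductivity.Theorems.CorrelationBudget

open Matrix Literature.Probability.LatticeModels Literature.MathematicalPhysics.QuantumLattice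
open scoped ComplexOrder

variable {L : ℕ} [NeZero L]

/-- Splitting of a Rayleigh quotient of `A + c • B` (`c` real) into real parts. -/
private theorem re_rayleigh_add_real_smul {ι : Type*} [Fintype ι] (A B : Matrix ι ι ℂ) (c : ℝ)
    (v : ι → ℂ) :
    (star v ⬝ᵥ ((A + ((c : ℝ) : ℂ) • B) *ᵥ v)).re =
      (star v ⬝ᵥ (A *ᵥ v)).re + c * (star v ⬝ᵥ (B *ᵥ v)).re := by
  rw [add_mulVec, Matrix.smul_mulVec, dotProduct_add, dotProduct_smul, smul_eq_mul, Complex.add_re,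
    Complex.re_ofReal_mul]

omit [NeZero L] in
/-- Splitting of the Hubbard Rayleigh quotient: `re⟨v, H_U v⟩ = re⟨v, H₀ v⟩ + U · re⟨v, D v⟩` with
`D = Σ_x n_{x↑} n_{x↓}`. -/
private theorem re_rayleigh_hubbardTorus_split (U : ℝ) (v : Fock (Orb (FermionTorus 2 L))) :
    (star v ⬝ᵥ (hubbardTorus 2 L 1 U *ᵥ v)).re =
      (star v ⬝ᵥ (hubbardTorus 2 L 1 0 *ᵥ v)).re +
        U * (star v ⬝ᵥ ((∑ x : FermionTorus 2 L, numberOp x 0 * numberOp x 1 :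
          Matrix (Finset (Orb (FermionTorus 2 L))) _ ℂ) *ᵥ v)).re := by
  rw [hubbardTorus_eq_zero_add_smul_interaction U]
  exact re_rayleigh_add_real_smul _ _ U v

/-- `K_{U,0} = H_U`: the crutch family at `g = 0` is the plain Hubbard torus. -/
private theorem crutch_zero (U : ℝ) :
    hubbardTorus 2 L 1 U + ((-(0 / (L : ℝ) ^ 2) : ℝ) : ℂ) •
        ((pairField dWaveFormFactor L)ᴴ * pairField dWaveFormFactor L) = hubbardTorus 2 L 1 U := by
  rw [zero_div, neg_zero, Complex.ofReal_zero, zero_smul, add_zero]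

/-- **Hartree balance on the crutch plane.** `L ≥ 3`, `U` real, `g ≥ 0`; `φ` a normalised ground
state of `K_{U,g} = hubbardTorus 2 L 1 U - (g/L²) Δ_dᴴΔ_d` in the sector `(2n, S^z = 0)`. Then
`re⟨φ, H₀ φ⟩ + U · re⟨φ, D φ⟩ ≤ E₀ + U · n²/L² + (g/L²) · re⟨φ, Δ_dᴴΔ_d φ⟩`: test `K_{U,g}` on the
paramagnetic paired Fermi sea `Φ_F` over a Fermi set with `|F| = n` (energy `E₀ + U n²/L²`,
`re_expect_hubbardTorus_pairedFermiSea`; its crutch term `-(g/L²)⟨Δ_dᴴΔ_d⟩ ≤ 0` is dropped).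
(`n ≤ L²` is automatic: `φ ≠ 0` lies in the sector.) For `U ≥ 0`, dropping `U · re⟨φ, D φ⟩ ≥ 0`
(`re_expect_interaction_torus_mem_Icc`) gives the kinetic excess bound `re⟨φ, H₀ φ⟩ - E₀ ≤ U n²/L² + w`,
the `U L²` of Theorem 36(i) (`crutch_groundState_kineticExcess_le`) sharpened to `U n²/L²`. [this work] -/
theorem crutch_groundState_hartree_balance (hL : 3 ≤ L) (U : ℝ) {g : ℝ} (hg : 0 ≤ g) {n : ℕ}
    {φ : Fock (Orb (FermionTorus 2 L))} (hφ1 : star φ ⬝ᵥ φ = 1)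
    (hφ : IsGroundStateInSector
      (hubbardTorus 2 L 1 U + ((-(g / (L : ℝ) ^ 2) : ℝ) : ℂ) •
        ((pairField dWaveFormFactor L)ᴴ * pairField dWaveFormFactor L)) (2 * n) 0 φ) :
    (star φ ⬝ᵥ (hubbardTorus 2 L 1 0 *ᵥ φ)).re +
        U * (star φ ⬝ᵥ ((∑ x : FermionTorus 2 L, numberOp x 0 * numberOp x 1 :
          Matrix (Finset (Orb (FermionTorus 2 L))) _ ℂ) *ᵥ φ)).re ≤
      (hubbardTorus 2 L 1 0).minEnergyOn (szSector (Λ := FermionTorus 2 L) (2 * n) 0) +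
        U * ((n : ℝ) ^ 2 / (L : ℝ) ^ 2) +
        g / (L : ℝ) ^ 2 *
          (star φ ⬝ᵥ (((pairField dWaveFormFactor L)ᴴ * pairField dWaveFormFactor L) *ᵥ φ)).re := by
  classical
  -- Hermitian operators
  have hOh : ((pairField dWaveFormFactor L)ᴴ * pairField dWaveFormFactor L).IsHermitian :=
    isHermitian_conjTranspose_mul_self _
  have hHU : (hubbardTorus 2 L 1 U).IsHermitian := LiebThm1.hamiltonian_isHermitian _ 1 U
  have hKh : (hubbardTorus 2 L 1 U + ((-(g / (L : ℝ) ^ 2) : ℝ) : ℂ) •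
      ((pairField dWaveFormFactor L)ᴴ * pairField dWaveFormFactor L)).IsHermitian :=
    isHermitian_add_ofReal_smul hHU hOh _
  obtain ⟨hmem, hne, hKφ⟩ := hφ
  -- `n ≤ |Λ*|`: the support of `φ` has an `n`-element `↑`-part
  have hsec : IsInSector n n φ := (mem_szSector_two_mul_zero_iff n φ).1 hmem
  obtain ⟨s, hs⟩ := Function.ne_iff.1 hne
  have hns : (upPart s).card = n := (not_imp_comm.1 (hsec s) hs).1
  have hn : n ≤ Fintype.card (TorusSite 2 L) := by
    have h1 : (upPart s).card ≤ Fintype.card (FermionTorus 2 L) := Finset.card_le_univ _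
    have h2 : Fintype.card (FermionTorus 2 L) = L ^ 2 := by simp
    have h3 : Fintype.card (TorusSite 2 L) = L ^ 2 := by simp [ZMod.card]
    omega
  -- the competitor: the paired Fermi sea over a Fermi set `F`, `|F| = n`
  obtain ⟨F, eF, hFc, hF, hF'⟩ := exists_fermiSet (torusBand L) hn
  set Φ : Fock (Orb (FermionTorus 2 L)) :=
    (List.map (fun q : TorusSite 2 L => (pairMode q)ᴴ) F.toList).prod *ᵥ
      (vacuum : Fock (Orb (FermionTorus 2 L))) with hΦ_def
  have hΦmem : Φ ∈ szSector (Λ := FermionTorus 2 L) (2 * n) 0 := by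
    have h := pairedState_mem_szSector (L := L) F.toList
    rwa [Finset.length_toList, hFc] at h
  have hΦ1 : star Φ ⬝ᵥ Φ = 1 := star_pairedState_dotProduct_self F.nodup_toList
  have hΦU : (star Φ ⬝ᵥ (hubbardTorus 2 L 1 U *ᵥ Φ)).re =
      (hubbardTorus 2 L 1 0).minEnergyOn (szSector (Λ := FermionTorus 2 L) (2 * n) 0) +
        U * ((n : ℝ) ^ 2 / (L : ℝ) ^ 2) := by
    rw [hΦ_def, re_expect_hubbardTorus_pairedFermiSea hL U F eF hF hF', hFc]
  -- variational principle for `K` on `Φ`, and `re⟨φ, Kφ⟩ = E_K`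
  have hvar := minEnergyOn_le_rayleigh_of_mem hKh _ hΦmem hΦ1
  have hφK : (star φ ⬝ᵥ ((hubbardTorus 2 L 1 U + ((-(g / (L : ℝ) ^ 2) : ℝ) : ℂ) •
      ((pairField dWaveFormFactor L)ᴴ * pairField dWaveFormFactor L)) *ᵥ φ)).re =
      (hubbardTorus 2 L 1 U + ((-(g / (L : ℝ) ^ 2) : ℝ) : ℂ) •
        ((pairField dWaveFormFactor L)ᴴ * pairField dWaveFormFactor L)).minEnergyOn
          (szSector (Λ := FermionTorus 2 L) (2 * n) 0) := by
    rw [hKφ, dotProduct_smul, smul_eq_mul, hφ1, mul_one, Complex.ofReal_re]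
  -- splittings of both Rayleigh quotients
  have hsφ := re_rayleigh_add_real_smul (hubbardTorus 2 L 1 U)
    ((pairField dWaveFormFactor L)ᴴ * pairField dWaveFormFactor L) (-(g / (L : ℝ) ^ 2)) φ
  have hsΦ := re_rayleigh_add_real_smul (hubbardTorus 2 L 1 U)
    ((pairField dWaveFormFactor L)ᴴ * pairField dWaveFormFactor L) (-(g / (L : ℝ) ^ 2)) Φ
  have huφ := re_rayleigh_hubbardTorus_split (L := L) U φ
  -- the crutch term of the competitor is non-positive
  have hOΦ : 0 ≤ (star Φ ⬝ᵥ
      (((pairField dWaveFormFactor L)ᴴ * pairField dWaveFormFactor L) *ᵥ Φ)).re :=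
    (posSemidef_conjTranspose_mul_self (pairField dWaveFormFactor L)).re_dotProduct_nonneg _
  have hL0 : (0 : ℝ) < L := by exact_mod_cast (by omega : 0 < L)
  have hgL : 0 ≤ g / (L : ℝ) ^ 2 := by positivity
  have h1 : 0 ≤ g / (L : ℝ) ^ 2 * (star Φ ⬝ᵥ
      (((pairField dWaveFormFactor L)ᴴ * pairField dWaveFormFactor L) *ᵥ Φ)).re :=
    mul_nonneg hgL hOΦ
  linarith

/-- **Supergradient transfer of a correlation budget.** `L ≥ 3`, `U, V ≥ 0`, `g ≥ 0`; `φ` a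
normalised ground state of `K_{U,g}` in the sector `(2n, S^z = 0)`; and suppose the paramagnetic
Hartree–Fock energy at the larger coupling `U + V` is accurate from below up to `Γ` in that sector:
`E₀ + (U+V) · n²/L² - Γ ≤ minEnergyOn (hubbardTorus 2 L 1 (U+V)) (szSector (2n) 0)` (e.g. Bach–Poelchau
1997). Then, with `w = (g/L²) re⟨φ, Δ_dᴴΔ_d φ⟩`:
`V · (n²/L² - re⟨φ, D φ⟩) ≤ Γ + w` and `V · (re⟨φ, H₀ φ⟩ - E₀) ≤ U · Γ + (U + V) · w`.
Proof: `φ` is a trial state at coupling `U + V` (`E_{U+V} ≤ re⟨φ,H₀φ⟩ + (U+V) re⟨φ,Dφ⟩`) against the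
Hartree balance at `U`. [this work] -/
theorem crutch_groundState_supergradient (hL : 3 ≤ L) {U V : ℝ} (hU : 0 ≤ U) (hV : 0 ≤ V) {g : ℝ}
    (hg : 0 ≤ g) {n : ℕ} {Γ : ℝ}
    (hΓ : (hubbardTorus 2 L 1 0).minEnergyOn (szSector (Λ := FermionTorus 2 L) (2 * n) 0) +
        (U + V) * ((n : ℝ) ^ 2 / (L : ℝ) ^ 2) - Γ ≤
      (hubbardTorus 2 L 1 (U + V)).minEnergyOn (szSector (Λ := FermionTorus 2 L) (2 * n) 0))
    {φ : Fock (Orb (FermionTorus 2 L))} (hφ1 : star φ ⬝ᵥ φ = 1)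
    (hφ : IsGroundStateInSector
      (hubbardTorus 2 L 1 U + ((-(g / (L : ℝ) ^ 2) : ℝ) : ℂ) •
        ((pairField dWaveFormFactor L)ᴴ * pairField dWaveFormFactor L)) (2 * n) 0 φ) :
    V * ((n : ℝ) ^ 2 / (L : ℝ) ^ 2 -
        (star φ ⬝ᵥ ((∑ x : FermionTorus 2 L, numberOp x 0 * numberOp x 1 :
          Matrix (Finset (Orb (FermionTorus 2 L))) _ ℂ) *ᵥ φ)).re) ≤
      Γ + g / (L : ℝ) ^ 2 *
        (star φ ⬝ᵥ (((pairField dWaveFormFactor L)ᴴ * pairField dWaveFormFactor L) *ᵥ φ)).re ∧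
    V * ((star φ ⬝ᵥ (hubbardTorus 2 L 1 0 *ᵥ φ)).re -
        (hubbardTorus 2 L 1 0).minEnergyOn (szSector (Λ := FermionTorus 2 L) (2 * n) 0)) ≤
      U * Γ + (U + V) * (g / (L : ℝ) ^ 2 *
        (star φ ⬝ᵥ (((pairField dWaveFormFactor L)ᴴ * pairField dWaveFormFactor L) *ᵥ φ)).re) := by
  have hbal := crutch_groundState_hartree_balance hL U hg hφ1 hφ
  -- `φ` as a trial state at coupling `U + V`
  have hH2 : (hubbardTorus 2 L 1 (U + V)).IsHermitian := LiebThm1.hamiltonian_isHermitian _ 1 (U + V)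
  have hvar := minEnergyOn_le_rayleigh_of_mem hH2 _ hφ.1 hφ1
  have hsplit := re_rayleigh_hubbardTorus_split (L := L) (U + V) φ
  -- abbreviations for the (nonlinear) atoms
  set T := (star φ ⬝ᵥ (hubbardTorus 2 L 1 0 *ᵥ φ)).re with hT
  set D := (star φ ⬝ᵥ ((∑ x : FermionTorus 2 L, numberOp x 0 * numberOp x 1 :
    Matrix (Finset (Orb (FermionTorus 2 L))) _ ℂ) *ᵥ φ)).re with hD
  set c := ((n : ℝ) ^ 2 / (L : ℝ) ^ 2) with hc
  set w := g / (L : ℝ) ^ 2 *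
    (star φ ⬝ᵥ (((pairField dWaveFormFactor L)ᴴ * pairField dWaveFormFactor L) *ᵥ φ)).re with hw
  set E₀ := (hubbardTorus 2 L 1 0).minEnergyOn (szSector (Λ := FermionTorus 2 L) (2 * n) 0) with hE₀
  -- (1) `V (c - D) ≤ Γ + w` (no signs needed)
  have hZ : V * (c - D) ≤ Γ + w := by linarith
  refine ⟨hZ, ?_⟩
  -- (2) `V (T - E₀) ≤ U Γ + (U + V) w`, using `U, V ≥ 0`
  have hK : T - E₀ ≤ U * (c - D) + w := by linarith
  have h3 : V * (T - E₀) ≤ V * (U * (c - D) + w) := mul_le_mul_of_nonneg_left hK hV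
  have h4 : U * (V * (c - D)) ≤ U * (Γ + w) := mul_le_mul_of_nonneg_left hZ hU
  linarith

/-- **The doubling form (Theorem 37).** `L ≥ 3`, `U` real, `g ≥ 0`; `φ` a normalised ground state of
`K_{U,g}` in the sector `(2n, S^z = 0)`; and at the DOUBLED coupling
`E₀ + 2U · n²/L² - Γ ≤ minEnergyOn (hubbardTorus 2 L 1 (2U)) (szSector (2n) 0)`. Then
`U · (n²/L² - re⟨φ, D φ⟩) ≤ Γ + w` and `re⟨φ, H₀ φ⟩ ≤ E₀ + Γ + 2w`, `w = (g/L²) re⟨φ, Δ_dᴴΔ_d φ⟩`: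
both the doublon deficit and the kinetic excess of EVERY crutch ground state are controlled by the
correlation budget at `2U` plus the crutch energy (no sign condition on `U` is needed). [this work] -/
theorem crutch_groundState_budget (hL : 3 ≤ L) {U : ℝ} {g : ℝ} (hg : 0 ≤ g) {n : ℕ} {Γ : ℝ}
    (hΓ : (hubbardTorus 2 L 1 0).minEnergyOn (szSector (Λ := FermionTorus 2 L) (2 * n) 0) +
        2 * U * ((n : ℝ) ^ 2 / (L : ℝ) ^ 2) - Γ ≤
      (hubbardTorus 2 L 1 (2 * U)).minEnergyOn (szSector (Λ := FermionTorus 2 L) (2 * n) 0))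
    {φ : Fock (Orb (FermionTorus 2 L))} (hφ1 : star φ ⬝ᵥ φ = 1)
    (hφ : IsGroundStateInSector
      (hubbardTorus 2 L 1 U + ((-(g / (L : ℝ) ^ 2) : ℝ) : ℂ) •
        ((pairField dWaveFormFactor L)ᴴ * pairField dWaveFormFactor L)) (2 * n) 0 φ) :
    U * ((n : ℝ) ^ 2 / (L : ℝ) ^ 2 -
        (star φ ⬝ᵥ ((∑ x : FermionTorus 2 L, numberOp x 0 * numberOp x 1 :
          Matrix (Finset (Orb (FermionTorus 2 L))) _ ℂ) *ᵥ φ)).re) ≤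
      Γ + g / (L : ℝ) ^ 2 *
        (star φ ⬝ᵥ (((pairField dWaveFormFactor L)ᴴ * pairField dWaveFormFactor L) *ᵥ φ)).re ∧
    (star φ ⬝ᵥ (hubbardTorus 2 L 1 0 *ᵥ φ)).re ≤
      (hubbardTorus 2 L 1 0).minEnergyOn (szSector (Λ := FermionTorus 2 L) (2 * n) 0) + Γ +
        2 * (g / (L : ℝ) ^ 2 *
          (star φ ⬝ᵥ (((pairField dWaveFormFactor L)ᴴ * pairField dWaveFormFactor L) *ᵥ φ)).re) := by
  have hbal := crutch_groundState_hartree_balance hL U hg hφ1 hφ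
  -- `φ` as a trial state at coupling `2U`
  have hH2 : (hubbardTorus 2 L 1 (2 * U)).IsHermitian := LiebThm1.hamiltonian_isHermitian _ 1 (2 * U)
  have hvar := minEnergyOn_le_rayleigh_of_mem hH2 _ hφ.1 hφ1
  have hsplit := re_rayleigh_hubbardTorus_split (L := L) (2 * U) φ
  constructor <;> linarith

/-- **Theorem 37(a): pair density against the budget (all fillings).** In the setting of
`crutch_groundState_budget`, if `φ` has `d`-wave pair density at least `a > 0`
(`a L⁴ ≤ re⟨φ, Δ_dᴴΔ_d φ⟩`, `a L² ≥ 4608`), then `a√a/32768 ≤ Γ/L² + 2g · re⟨φ, Δ_dᴴΔ_d φ⟩/L⁴`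
(kinetic pairing cost `freeDWavePairing_costs_energy_opt_explicit`, Literature, against the transferred
budget). [this work] -/
theorem crutch_groundState_pairDensity_budget (hL : 3 ≤ L) {U : ℝ} {g : ℝ} (hg : 0 ≤ g) {n : ℕ}
    {Γ : ℝ}
    (hΓ : (hubbardTorus 2 L 1 0).minEnergyOn (szSector (Λ := FermionTorus 2 L) (2 * n) 0) +
        2 * U * ((n : ℝ) ^ 2 / (L : ℝ) ^ 2) - Γ ≤
      (hubbardTorus 2 L 1 (2 * U)).minEnergyOn (szSector (Λ := FermionTorus 2 L) (2 * n) 0))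
    {φ : Fock (Orb (FermionTorus 2 L))} (hφ1 : star φ ⬝ᵥ φ = 1)
    (hφ : IsGroundStateInSector
      (hubbardTorus 2 L 1 U + ((-(g / (L : ℝ) ^ 2) : ℝ) : ℂ) •
        ((pairField dWaveFormFactor L)ᴴ * pairField dWaveFormFactor L)) (2 * n) 0 φ)
    {a : ℝ} (ha : 0 < a) (hLa : 4608 ≤ a * (L : ℝ) ^ 2)
    (hY : a * (L : ℝ) ^ 4 ≤
      (star φ ⬝ᵥ (((pairField dWaveFormFactor L)ᴴ * pairField dWaveFormFactor L) *ᵥ φ)).re) :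
    a * Real.sqrt a / 32768 ≤
      Γ / (L : ℝ) ^ 2 + 2 * g *
        ((star φ ⬝ᵥ (((pairField dWaveFormFactor L)ᴴ * pairField dWaveFormFactor L) *ᵥ φ)).re /
          (L : ℝ) ^ 4) := by
  have h1 := (crutch_groundState_budget hL hg hΓ hφ1 hφ).2
  have h2 := freeDWavePairing_costs_energy_opt_explicit ha hL hLa hφ.1 hφ1 hY
  have hL0 : (0 : ℝ) < L := by exact_mod_cast (by omega : 0 < L)
  have hL2 : (0 : ℝ) < (L : ℝ) ^ 2 := by positivity
  have key : a * Real.sqrt a / 32768 * (L : ℝ) ^ 2 ≤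
      (Γ / (L : ℝ) ^ 2 + 2 * g *
        ((star φ ⬝ᵥ (((pairField dWaveFormFactor L)ᴴ * pairField dWaveFormFactor L) *ᵥ φ)).re /
          (L : ℝ) ^ 4)) * (L : ℝ) ^ 2 := by
    have e : (Γ / (L : ℝ) ^ 2 + 2 * g *
        ((star φ ⬝ᵥ (((pairField dWaveFormFactor L)ᴴ * pairField dWaveFormFactor L) *ᵥ φ)).re /
          (L : ℝ) ^ 4)) * (L : ℝ) ^ 2 =
        Γ + 2 * (g / (L : ℝ) ^ 2 *
          (star φ ⬝ᵥ (((pairField dWaveFormFactor L)ᴴ * pairField dWaveFormFactor L) *ᵥ φ)).re) := by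
      field_simp
    rw [e]
    linarith
  exact le_of_mul_le_mul_right key hL2

/-- **Theorem 37(b): summit fillings, logarithmic cost.** As in `crutch_groundState_pairDensity_budget`,
with the Fermi level of the sector pinned into `[-4 + d₀, -d₀]` by the counting hypotheses `hC1`, `hC2`
of `FreeFermiGasPairingCostLog.lean` (at filling `1 - δ`, `δ ∈ (0,1/2)`: `d₀ ≍ δ²`), `a L² ≥ 12800`,
`√d₀ L ≥ 40`: `√d₀ · a/(4096 · log(4 + 32/√a)) ≤ Γ/L² + 2g · re⟨φ, Δ_dᴴΔ_d φ⟩/L⁴`. [this work] -/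
theorem crutch_groundState_pairDensity_log_budget (hL : 3 ≤ L) {U : ℝ} {g : ℝ} (hg : 0 ≤ g)
    {d₀ : ℝ} (hd : 0 < d₀) (hLd : 40 ≤ Real.sqrt d₀ * L) {n : ℕ}
    (hC1 : n ≤ (Finset.univ.filter fun k : TorusSite 2 L => torusBand L k ≤ -d₀).card)
    (hC2 : (Finset.univ.filter fun k : TorusSite 2 L => torusBand L k < (-4 : ℝ) + d₀).card < n)
    {Γ : ℝ}
    (hΓ : (hubbardTorus 2 L 1 0).minEnergyOn (szSector (Λ := FermionTorus 2 L) (2 * n) 0) +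
        2 * U * ((n : ℝ) ^ 2 / (L : ℝ) ^ 2) - Γ ≤
      (hubbardTorus 2 L 1 (2 * U)).minEnergyOn (szSector (Λ := FermionTorus 2 L) (2 * n) 0))
    {φ : Fock (Orb (FermionTorus 2 L))} (hφ1 : star φ ⬝ᵥ φ = 1)
    (hφ : IsGroundStateInSector
      (hubbardTorus 2 L 1 U + ((-(g / (L : ℝ) ^ 2) : ℝ) : ℂ) •
        ((pairField dWaveFormFactor L)ᴴ * pairField dWaveFormFactor L)) (2 * n) 0 φ)
    {a : ℝ} (ha : 0 < a) (hLa : 12800 ≤ a * (L : ℝ) ^ 2)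
    (hY : a * (L : ℝ) ^ 4 ≤
      (star φ ⬝ᵥ (((pairField dWaveFormFactor L)ᴴ * pairField dWaveFormFactor L) *ᵥ φ)).re) :
    Real.sqrt d₀ * a / (4096 * Real.log (4 + 32 / Real.sqrt a)) ≤
      Γ / (L : ℝ) ^ 2 + 2 * g *
        ((star φ ⬝ᵥ (((pairField dWaveFormFactor L)ᴴ * pairField dWaveFormFactor L) *ᵥ φ)).re /
          (L : ℝ) ^ 4) := by
  have h1 := (crutch_groundState_budget hL hg hΓ hφ1 hφ).2
  have h2 := freeDWavePairing_costs_energy_log_explicit ha hd hL hLa hLd hφ.1 hφ1 hC1 hC2 hY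
  have hL0 : (0 : ℝ) < L := by exact_mod_cast (by omega : 0 < L)
  have hL2 : (0 : ℝ) < (L : ℝ) ^ 2 := by positivity
  have key : Real.sqrt d₀ * a / (4096 * Real.log (4 + 32 / Real.sqrt a)) * (L : ℝ) ^ 2 ≤
      (Γ / (L : ℝ) ^ 2 + 2 * g *
        ((star φ ⬝ᵥ (((pairField dWaveFormFactor L)ᴴ * pairField dWaveFormFactor L) *ᵥ φ)).re /
          (L : ℝ) ^ 4)) * (L : ℝ) ^ 2 := by
    have e : (Γ / (L : ℝ) ^ 2 + 2 * g *
        ((star φ ⬝ᵥ (((pairField dWaveFormFactor L)ᴴ * pairField dWaveFormFactor L) *ᵥ φ)).re /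
          (L : ℝ) ^ 4)) * (L : ℝ) ^ 2 =
        Γ + 2 * (g / (L : ℝ) ^ 2 *
          (star φ ⬝ᵥ (((pairField dWaveFormFactor L)ᴴ * pairField dWaveFormFactor L) *ᵥ φ)).re) := by
      field_simp
    rw [e]
    linarith
  exact le_of_mul_le_mul_right key hL2

/-- **Theorem 37(c): the plain Hubbard torus (`g = 0`).** `L ≥ 3`, `U` real; `φ` ANY normalised ground
state of the `(2n, S^z = 0)` sector of `hubbardTorus 2 L 1 U`; at the doubled coupling
`E₀ + 2U · n²/L² - Γ ≤ minEnergyOn (hubbardTorus 2 L 1 (2U)) (szSector (2n) 0)`. Then the kinetic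
excess and the doublon deficit of `φ` are both at most the budget:
`re⟨φ, H₀ φ⟩ - E₀ ≤ Γ` and `U · (n²/L² - re⟨φ, D φ⟩) ≤ Γ` (with Bach–Poelchau: `O(U^{4/3}|ln U| L²)`
in place of the first-order `U n²/L²` of `kineticExcess_le_of_groundStateInSector`). [this work] -/
theorem hubbard_groundState_budget (hL : 3 ≤ L) {U : ℝ} {n : ℕ} {Γ : ℝ}
    (hΓ : (hubbardTorus 2 L 1 0).minEnergyOn (szSector (Λ := FermionTorus 2 L) (2 * n) 0) +
        2 * U * ((n : ℝ) ^ 2 / (L : ℝ) ^ 2) - Γ ≤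
      (hubbardTorus 2 L 1 (2 * U)).minEnergyOn (szSector (Λ := FermionTorus 2 L) (2 * n) 0))
    {φ : Fock (Orb (FermionTorus 2 L))} (hφ1 : star φ ⬝ᵥ φ = 1)
    (hφ : IsGroundStateInSector (hubbardTorus 2 L 1 U) (2 * n) 0 φ) :
    (star φ ⬝ᵥ (hubbardTorus 2 L 1 0 *ᵥ φ)).re -
        (hubbardTorus 2 L 1 0).minEnergyOn (szSector (Λ := FermionTorus 2 L) (2 * n) 0) ≤ Γ ∧
    U * ((n : ℝ) ^ 2 / (L : ℝ) ^ 2 -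
        (star φ ⬝ᵥ ((∑ x : FermionTorus 2 L, numberOp x 0 * numberOp x 1 :
          Matrix (Finset (Orb (FermionTorus 2 L))) _ ℂ) *ᵥ φ)).re) ≤ Γ := by
  have hφ' : IsGroundStateInSector
      (hubbardTorus 2 L 1 U + ((-(0 / (L : ℝ) ^ 2) : ℝ) : ℂ) •
        ((pairField dWaveFormFactor L)ᴴ * pairField dWaveFormFactor L)) (2 * n) 0 φ := by
    rwa [crutch_zero]
  have h := crutch_groundState_budget hL le_rfl hΓ hφ1 hφ'
  simp only [zero_div, zero_mul, mul_zero, add_zero] at h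
  exact ⟨by linarith [h.2], h.1⟩

/-- **Theorem 37(d): pair density of every Hubbard ground state against the budget (all fillings).**
`g = 0` in `crutch_groundState_pairDensity_budget`: for every normalised sector ground state `φ` of
`hubbardTorus 2 L 1 U` with `a L⁴ ≤ re⟨φ, Δ_dᴴΔ_d φ⟩`, `a L² ≥ 4608`, `a > 0`:
`a√a/32768 ≤ Γ/L²`. [this work] -/
theorem hubbard_groundState_pairDensity_budget (hL : 3 ≤ L) {U : ℝ} {n : ℕ} {Γ : ℝ}
    (hΓ : (hubbardTorus 2 L 1 0).minEnergyOn (szSector (Λ := FermionTorus 2 L) (2 * n) 0) +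
        2 * U * ((n : ℝ) ^ 2 / (L : ℝ) ^ 2) - Γ ≤
      (hubbardTorus 2 L 1 (2 * U)).minEnergyOn (szSector (Λ := FermionTorus 2 L) (2 * n) 0))
    {φ : Fock (Orb (FermionTorus 2 L))} (hφ1 : star φ ⬝ᵥ φ = 1)
    (hφ : IsGroundStateInSector (hubbardTorus 2 L 1 U) (2 * n) 0 φ)
    {a : ℝ} (ha : 0 < a) (hLa : 4608 ≤ a * (L : ℝ) ^ 2)
    (hY : a * (L : ℝ) ^ 4 ≤
      (star φ ⬝ᵥ (((pairField dWaveFormFactor L)ᴴ * pairField dWaveFormFactor L) *ᵥ φ)).re) :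
    a * Real.sqrt a / 32768 ≤ Γ / (L : ℝ) ^ 2 := by
  have hφ' : IsGroundStateInSector
      (hubbardTorus 2 L 1 U + ((-(0 / (L : ℝ) ^ 2) : ℝ) : ℂ) •
        ((pairField dWaveFormFactor L)ᴴ * pairField dWaveFormFactor L)) (2 * n) 0 φ := by
    rwa [crutch_zero]
  have h := crutch_groundState_pairDensity_budget hL le_rfl hΓ hφ1 hφ' ha hLa hY
  simp only [mul_zero, zero_mul, add_zero] at h
  exact h

/-- **Theorem 37(e): summit fillings, every Hubbard ground state, logarithmic cost.** `g = 0` in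
`crutch_groundState_pairDensity_log_budget`: `√d₀ · a/(4096 · log(4 + 32/√a)) ≤ Γ/L²` for every
normalised sector ground state of `hubbardTorus 2 L 1 U` with `d`-wave pair density at least `a`
(`a L² ≥ 12800`, Fermi level in `[-4 + d₀, -d₀]`, `√d₀ L ≥ 40`). With the Bach–Poelchau budget this is the
every-ground-state ceiling `√d₀ · y/log(4 + 32/√y) ≲ U^{4/3}(1 + |ln U|)` of the module docstring. [this work] -/
theorem hubbard_groundState_pairDensity_log_budget (hL : 3 ≤ L) {U : ℝ} {d₀ : ℝ} (hd : 0 < d₀)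
    (hLd : 40 ≤ Real.sqrt d₀ * L) {n : ℕ}
    (hC1 : n ≤ (Finset.univ.filter fun k : TorusSite 2 L => torusBand L k ≤ -d₀).card)
    (hC2 : (Finset.univ.filter fun k : TorusSite 2 L => torusBand L k < (-4 : ℝ) + d₀).card < n)
    {Γ : ℝ}
    (hΓ : (hubbardTorus 2 L 1 0).minEnergyOn (szSector (Λ := FermionTorus 2 L) (2 * n) 0) +
        2 * U * ((n : ℝ) ^ 2 / (L : ℝ) ^ 2) - Γ ≤
      (hubbardTorus 2 L 1 (2 * U)).minEnergyOn (szSector (Λ := FermionTorus 2 L) (2 * n) 0))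
    {φ : Fock (Orb (FermionTorus 2 L))} (hφ1 : star φ ⬝ᵥ φ = 1)
    (hφ : IsGroundStateInSector (hubbardTorus 2 L 1 U) (2 * n) 0 φ)
    {a : ℝ} (ha : 0 < a) (hLa : 12800 ≤ a * (L : ℝ) ^ 2)
    (hY : a * (L : ℝ) ^ 4 ≤
      (star φ ⬝ᵥ (((pairField dWaveFormFactor L)ᴴ * pairField dWaveFormFactor L) *ᵥ φ)).re) :
    Real.sqrt d₀ * a / (4096 * Real.log (4 + 32 / Real.sqrt a)) ≤ Γ / (L : ℝ) ^ 2 := by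
  have hφ' : IsGroundStateInSector
      (hubbardTorus 2 L 1 U + ((-(0 / (L : ℝ) ^ 2) : ℝ) : ℂ) •
        ((pairField dWaveFormFactor L)ᴴ * pairField dWaveFormFactor L)) (2 * n) 0 φ := by
    rwa [crutch_zero]
  have h := crutch_groundState_pairDensity_log_budget hL le_rfl hd hLd hC1 hC2 hΓ hφ1 hφ' ha hLa hY
  simp only [mul_zero, zero_mul, add_zero] at h
  exact h

end Summit.HubbardSuperconductivity.HubbardSuperconductivity.Theorems.CorrelationBudget
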